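import Summits.CriticalPhenomena.Ising3D.Control2DReadoutKernel
import Mathlib.Tactic.Linarith
import Mathlib.Tactic.Positivity
import Mathlib.Tactic.NormNum
import HarnessLib

/-!
# Readout certificates: the Boolean check and its soundness (cell `pub-ising3x`, seat controls-1 gen 29; KERNEL PATH,
certificate kind "readout" — CONTROL-ONLY)

HONEST FRAMING: lottery ticket; floor = tightest certified 3D Ising CFT bounds; no exact-solution
claim without a proof. CONTROL-ONLY (`d = 2`, `Δ_σ = 1/8`); nothing numerical is asserted here.

From the enclosure `Control2DReadoutKernel.blockAction0_mem` at each of four rational dimensions (true level `t`, bracket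
`a < m < b ≤ m + 1`), ONE Boolean `readoutCheck wt Sl Λ N t a m b = true` (ranges + three rational inequalities between the
enclosure ends; `halfPow` strictly antitone, `halfPow b ≥ halfPow m / 2`) yields the three strict inequalities
`f(m) < f(a)`, `f(m) < f(b)`, `f(m) < f(t)` of a displaced dip of `f(Δ) = φ[F^{1/8}_-[g_{Δ,0}]]` (`dip0_of_readoutCheck`) —
the body of the T-2 obligation nodes `CFDipΛ` (`Control2DConjectureCF`). Measured (farm; B17 = the Λ = 17, 45-component table
`wtboxY`, `N = 160`, four dimensions): the whole `decide +kernel` takes ≈ 70 s (the one-pass vector `uVecQ` makes it linear in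
the table size). Elementary; no facts, standard axioms only. [cite: RattazziEtAl2008, §5.5]
-/

namespace Summit.CriticalPhenomena.Ising3D.Control2D

open Finset Set
open Literature.MathematicalPhysics.QuantumFieldTheory.ConformalBootstrap3D

/-! ### The Boolean readout check and its soundness -/

/-- Range conditions of the enclosure at one dimension. [folklore] -/
def rangeOk (Δ : ℚ) : Bool :=
  decide (0 < Δ) && decide (Δ ≤ 6) && decide (Δ * (Δ - 4) ≤ 4)

/-- [folklore] -/
theorem rangeOk_sound {Δ : ℚ} (h : rangeOk Δ = true) : 0 < Δ ∧ Δ ≤ 6 ∧ Δ * (Δ - 4) ≤ 4 := by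
  unfold rangeOk at h
  simp only [Bool.and_eq_true, decide_eq_true_eq] at h
  exact ⟨h.1.1, h.1.2, h.2⟩

/-- **The readout check** of a displaced dip in the scalar channel at `Δ_σ = 1/8` for the integer table `wt` on `Sl`
(indices `≤ Λ`), truncation `N`, true level `t`, bracket `a < m < b` (`b ≤ m + 1`): ranges, and with
`L(x) = headQ(x) - errQ(x)`, `U(x) = headQ(x) + errQ(x)`: `0 < L(a)`, `U(m) ≤ L(a)`; `0 < L(t)`, `U(m) ≤ L(t)`; `0 < L(b)`,
`2 U(m) < L(b)`. This is what `decide` evaluates. [folklore] -/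
def readoutCheck (wt : ℕ × ℕ → ℤ) (Sl : List (ℕ × ℕ)) (Λ N : ℕ) (t a m b : ℚ) : Bool :=
  let H := fun Δ : ℚ => headQv wt Sl (1 / 8) (Δ / 2) N Λ
  let E := fun Δ : ℚ => errQ wt Sl Δ N Λ
  rangeOk t && rangeOk a && rangeOk m && rangeOk b && decide (Λ < N + 5) &&
    decide (a < m) && decide (t < m) && decide (m < b) && decide (b ≤ m + 1) &&
    decide (0 < H a - E a) && decide (H m + E m ≤ H a - E a) &&
    decide (0 < H t - E t) && decide (H m + E m ≤ H t - E t) &&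
    decide (0 < H b - E b) && decide (2 * (H m + E m) < H b - E b)

/-- From an upper enclosure at `m`, a positive lower enclosure at `x < m` dominating it: `f(m) < f(x)`. [folklore] -/
theorem lt_of_enclosures_left {fm fx Um Lx : ℝ} {m x : ℝ} (hxm : x < m) (hfm : fm ≤ halfPow m * Um)
    (hfx : halfPow x * Lx ≤ fx) (hL : 0 < Lx) (hUL : Um ≤ Lx) : fm < fx := by
  have hPx := halfPow_pos x
  have hPm := halfPow_pos m
  have hPlt := halfPow_lt_halfPow hxm
  rcases le_or_gt Um 0 with hU | hU
  · calc fm ≤ halfPow m * Um := hfm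
      _ ≤ 0 := mul_nonpos_of_nonneg_of_nonpos hPm.le hU
      _ < halfPow x * Lx := mul_pos hPx hL
      _ ≤ fx := hfx
  · calc fm ≤ halfPow m * Um := hfm
      _ < halfPow x * Um := mul_lt_mul_of_pos_right hPlt hU
      _ ≤ halfPow x * Lx := mul_le_mul_of_nonneg_left hUL hPx.le
      _ ≤ fx := hfx

/-- From an upper enclosure at `m`, a positive lower enclosure at `b ∈ (m, m+1]` exceeding twice it: `f(m) < f(b)`. [folklore] -/
theorem lt_of_enclosures_right {fm fb Um Lb : ℝ} {m b : ℝ} (hb : b ≤ m + 1) (hfm : fm ≤ halfPow m * Um)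
    (hfb : halfPow b * Lb ≤ fb) (hL : 0 < Lb) (hUL : 2 * Um < Lb) : fm < fb := by
  have hPb := halfPow_pos b
  have hPm := halfPow_pos m
  have hhalf := halfPow_ge_half hb
  rcases le_or_gt Um 0 with hU | hU
  · calc fm ≤ halfPow m * Um := hfm
      _ ≤ 0 := mul_nonpos_of_nonneg_of_nonpos hPm.le hU
      _ < halfPow b * Lb := mul_pos hPb hL
      _ ≤ fb := hfb
  · calc fm ≤ halfPow m * Um := hfm
      _ = (halfPow m / 2) * (2 * Um) := by ring
      _ ≤ halfPow b * (2 * Um) := mul_le_mul_of_nonneg_right hhalf (by linarith)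
      _ < halfPow b * Lb := mul_lt_mul_of_pos_left hUL hPb
      _ ≤ fb := hfb

/-- **Soundness of the readout check** (`Δ_σ = 1/8`, scalar channel): `readoutCheck wt Sl Λ N t a m b = true` for the integer
table `wt` on the duplicate-free list `Sl` (all `p₁ + p₂ ≤ Λ`) gives the displaced-dip inequalities of the table functional
`φ = taylorFunctional2D (1/2) Sl.toFinset wt`: `f(m) < f(a)`, `f(m) < f(b)`, `f(m) < f(t)` with `f(x) = φ[F^{1/8}_-[g_{x,0}]]`.
[cite: RattazziEtAl2008, §5.5] -/
theorem dip0_of_readoutCheck (wt : ℕ × ℕ → ℤ) {Sl : List (ℕ × ℕ)} (hnd : Sl.Nodup) {Λ : ℕ}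
    (hdeg : ∀ p ∈ Sl, p.1 + p.2 ≤ Λ) {N : ℕ} {t a m b : ℚ}
    (hchk : readoutCheck wt Sl Λ N t a m b = true) :
    taylorFunctional2D (1 / 2) Sl.toFinset (fun p => (wt p : ℝ)) (crossF (1 / 8) (-1) (globalBlock (m : ℝ) 0)) <
        taylorFunctional2D (1 / 2) Sl.toFinset (fun p => (wt p : ℝ)) (crossF (1 / 8) (-1) (globalBlock (a : ℝ) 0)) ∧
      taylorFunctional2D (1 / 2) Sl.toFinset (fun p => (wt p : ℝ)) (crossF (1 / 8) (-1) (globalBlock (m : ℝ) 0)) <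
        taylorFunctional2D (1 / 2) Sl.toFinset (fun p => (wt p : ℝ)) (crossF (1 / 8) (-1) (globalBlock (b : ℝ) 0)) ∧
      taylorFunctional2D (1 / 2) Sl.toFinset (fun p => (wt p : ℝ)) (crossF (1 / 8) (-1) (globalBlock (m : ℝ) 0)) <
        taylorFunctional2D (1 / 2) Sl.toFinset (fun p => (wt p : ℝ)) (crossF (1 / 8) (-1) (globalBlock (t : ℝ) 0)) := by
  unfold readoutCheck at hchk
  simp only [Bool.and_eq_true, decide_eq_true_eq, headQv_eq_headQ wt hdeg] at hchk
  obtain ⟨⟨⟨⟨⟨⟨⟨⟨⟨⟨⟨⟨⟨⟨ht, ha⟩, hm⟩, hb⟩, hN⟩, ham⟩, htm⟩, hmb⟩, hbm⟩, hLa⟩, hULa⟩, hLt⟩, hULt⟩, hLb⟩, hULb⟩ :=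
    hchk
  obtain ⟨ht0, ht6, htq⟩ := rangeOk_sound ht
  obtain ⟨ha0, ha6, haq⟩ := rangeOk_sound ha
  obtain ⟨hm0, hm6, hmq⟩ := rangeOk_sound hm
  obtain ⟨hb0, hb6, hbq⟩ := rangeOk_sound hb
  obtain ⟨-, hUm⟩ := blockAction0_mem wt hnd hdeg hm0 hm6 hmq hN
  obtain ⟨hLa', -⟩ := blockAction0_mem wt hnd hdeg ha0 ha6 haq hN
  obtain ⟨hLt', -⟩ := blockAction0_mem wt hnd hdeg ht0 ht6 htq hN
  obtain ⟨hLb', -⟩ := blockAction0_mem wt hnd hdeg hb0 hb6 hbq hN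
  refine ⟨?_, ?_, ?_⟩
  · exact lt_of_enclosures_left (by exact_mod_cast ham) hUm hLa' (by exact_mod_cast hLa) (by exact_mod_cast hULa)
  · refine lt_of_enclosures_right (by exact_mod_cast hbm) hUm hLb' (by exact_mod_cast hLb) ?_
    have : (((2 * (headQ wt Sl (1 / 8) (m / 2) N + errQ wt Sl m N Λ) : ℚ)) : ℝ) <
        (((headQ wt Sl (1 / 8) (b / 2) N - errQ wt Sl b N Λ) : ℚ) : ℝ) := by exact_mod_cast hULb
    push_cast at this ⊢
    linarith
  · exact lt_of_enclosures_left (by exact_mod_cast htm) hUm hLt' (by exact_mod_cast hLt) (by exact_mod_cast hULt)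

end Summit.CriticalPhenomena.Ising3D.Control2D
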